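import Mathlib
import HarnessLib
import HarnessLib.Audit
import Summits.PneNP.Statement
import Literature.Computability.Complexity.Classes
import Literature.Computability.Complexity.Nondeterministic
import Literature.Computability.Complexity.BoolEncodings
import Summits.PneNP.PneNP.Theorems.SzkEntropyCookModelBridge
import HarnessLib.Audit.Status.Attr

/-!
Route: DelsarteLasserre

DORMANT since 2026-08-22T12:54:43Z (reconciler: no traction for 5.3 d (last activity item-evidence-added at 2026-08-17T04:03:36Z); parked, not closed — `ledger route dormant route-PneNP-DelsarteLasserre --off` to reactivate) — unstaffed, not closed; items shared with open routes are served there. `ledger route dormant <id> --off` reactivates.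

Thesis X (card PneNP/PneNP/delsarte-unfinished-lasserre-exactness, "Delsarte's programme cannot be
finished"): the code-size function A(n,d) = max |C|, C ⊆ {0,1}^n of minimum distance ≥ d (=
independence number of the conflict graph H(n,d) on {0,1}^n, u ~ v iff 1 ≤ dist(u,v) ≤ d−1), read at
EXPONENTIAL SCALE, is not computable in time 2^{poly(n)}: the language L_code = { ⟨1^n, ⟨1^d, u⟩⟩ :
bitsToNat u ≤ A(n,d) } (n, d unary, the threshold M binary; input length Θ(n) on non-degenerate
inputs) is not in EXP.
Lean (decl Target): ({w : List Bool | ∃ n d : ℕ, ∃ u : List Bool, w = boolPair (List.replicate n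
true) (boolPair (List.replicate d true) u) ∧ bitsToNat u ≤ (SimpleGraph.fromRel fun x y : Fin n →
Bool => hammingDist x y < d).indepNum} : Language Bool) ∉ Literature.Computability.Complexity.EXP
(boolPair, bitsToNat, EXP from Literature/Computability/Complexity/{BoolEncodings,Classes}.lean;
hammingDist, SimpleGraph.indepNum from Mathlib).
It suffices: L_code ∈ NEXP (guess a code of M words, check the 4^n·n pairwise distances; support
item CodeSizeLangInNEXP) and NP ⊆ P ⟹ NEXP ⊆ EXP (upward padding, Book 1974 /
Hartmanis–Immerman–Sewelson 1985; support item NexpSubsetExpOfNpSubsetP, ten lines over the tree's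
exists_pad_mem_NP, lpad_mem_FE, preimage_mem_E, padPre_mem_NTIME_two_pow, karpReducible_padPre,
mem_EXP_of_karpReducible); so ¬PneNP ⟹ (model bridges: support item ClassBridges = the PROVED facts
P_bool_eq ∧ NP_bool_eq written over their definientia, so that the route module imports nothing
beyond Classes/Nondeterministic/BoolEncodings) NP ⊆ P ⟹ L_code ∈ EXP ⟹ ¬X. Deciding theorem (rev 2,
certified by the native audit): closes : Target → CodeSizeLangInNEXP → NexpSubsetExpOfNpSubsetP →
ClassBridges → PneNP, five lines of logic in the route file; the Assembly item is restated
accordingly as CodeSizeLangInNEXP → NexpSubsetExpOfNpSubsetP → ClassBridges → Target → PneNP (same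
content as rev 1, whose unlisted hypotheses P_bool_eq → NP_bool_eq are now the listed item
ClassBridges) and is provable now (closes does not assume it).
The route exists for the COMPUTABLE SHADOW of X: if the Lasserre/Laurent SDP hierarchy for A(n,d)
[Laurent2006 (22): ℓ^(k) = max Σ_v y_v s.t. M_k(y) ⪰ 0, y_∅ = 1, y_uv = 0 on conflicts; here with y
≥ 0 added, so level 1 = ϑ′ = Delsarte's LP bound, Schrijver1979/Laurent2006 p.241] were exact UP TO
A MARGIN θ < 1 at a polynomial level p (A(n,d) ≤ ℓ^(p(n))(n,d) < A(n,d) + θ for all large n and all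
d), then a (1−θ)/3-approximation ℓ̃ of the level-p(n) SDP value (dimension 2^{O(n·p(n))}, time
2^{poly(n)} [DeklerkVallentin2016]) pins A(n,d) down as the unique integer in [ℓ̃−ε−θ, ℓ̃+ε], and
A(n,d) would be computable in 2^{poly(n)} — exactly what P = NP promises. (The FLOOR form ⌊ℓ⌋ = A is
not enough for this implication: ⌊ℓ⌋ cannot be read off an approximate value when ℓ ∈ [A+1−2ε, A+1);
refuter reviews 05747519/c3ba3f2b — hence rev 2 states the rungs in margin form.) So X forces the
ranked rungs: (rank 2) PolyLevelLasserreMarginInexact — for every polynomial p and every θ < 1,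
ℓ^(p(n))(n,d) ≥ A(n,d) + θ for infinitely many (n,d); (rank 3) DelsarteBoundInexactOnRay — for some
δ ∈ (0,1/2), Delsarte's bound exceeds A(n,⌊δn⌋) by ≥ 1 for infinitely many n (floor form kept: this
is the classical 'Delsarte's bound is not tight' on a constant-rate ray); (rank 4)
ConstantLevelLasserreMarginInexact — no fixed level k is exact within any margin θ < 1 (the shadow
of the weaker thesis L_code ∉ E, which also suffices for PneNP).

Rationale: WHY THIS LINE (coding theory × SOS/association schemes × the Hartmanis tally axis). P = NP would let
Delsarte's programme be completed by brute authority: A(n,d) ≥ M is an NEXP question on O(n) input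
bits (witness: the code, ≤ n·2^n bits), so NP ⊆ P ⟹ NEXP ⊆ EXP [Book1974;
HartmanisImmermanSewelson1985] would compute every A(n,d) in time 2^{poly(n)}, against brute force
2^{Θ(2^n)} and against sixty years of tables in which each new value is a paper (2720 ≤ A(17,4) ≤
3276 still open). Thesis X (Target) = "L_code ∉ EXP". X itself is NEXP ≠ EXP-hard in spirit (no
prover is expected to close Target); the value of the route is its computable shadow, typed as
finite-dimensional PSD statements on ONE explicit vertex-transitive graph family: the
Lasserre/Laurent hierarchy ℓ^(k)(H(n,d)) [Laurent2003; Laurent2006 (22), p.248: α ≤ ℓ^(k), equality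
for k ≥ α; level 1 (+nonnegativity) = ϑ′ = Delsarte's LP bound, Schrijver1979, Laurent2006 p.241;
Schrijver2005 sits between levels 1 and 2] is the only general upper-bound technology for A(n,d),
and "exact within a margin θ < 1 at polynomial level" would BE the 2^{poly(n)} algorithm
(approximate an SDP of dimension 2^{O(n·p(n))} to (1−θ)/3 and round; DeklerkVallentin2016). Imported
areas: SOS degree lower bounds on symmetric instances [KurpiszLeppanenMastrolilli2019; Laurent2003],
Terwilliger-algebra block diagonalisation [Schrijver2005; Laurent2006;
GijswijtMittelmannSchrijver2012], LP-hierarchy completeness/duals for codes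
[CoreglianoJeronimoJones2022; CoreglianoJeronimoJones2023; CoreglianoJeronimoJonesLinialLoyfer2025:
"analysis of all known convex programming hierarchies strengthening Delsarte's original LPs has
turned out to be exceedingly difficult and essentially nothing is known" (p.1)], and the tree's
padding toolkit (ExpPadding/NTIMEPadding/AvgCaseNE) for the frame.
FRAME (support, routine; rev 2 = route-repair 2026-08-15): CodeSizeLangInNEXP (verifier via
mem_NTIME_of_prefixMachine + CodeFP bricks: nodup, all, pairwise hammingDist);
NexpSubsetExpOfNpSubsetP (10 lines over exists_pad_mem_NP, lpad_mem_FE, preimage_mem_E,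
padPre_mem_NTIME_two_pow, karpReducible_padPre, mem_EXP_of_karpReducible); ClassBridges (PNPWave0.P
Bool = Classes.P ∧ PNPWave0.NP Bool = Nondeterministic.NP — literally the proved Literature facts
P_bool_eq ∧ NP_bool_eq, one line: ⟨P_bool_eq_holds, NP_bool_eq_holds⟩ from ClayProblem(Proofs).lean,
checked sorry-free in the planner's BridgeEvidence.lean; stated over the definientia so that the
route module no longer imports ClayProblem.lean, whose OPEN conjecture NPNotSubsetPPoly rode into
the import cone unused and blocked staffing). The deciding theorem closes : Target →
CodeSizeLangInNEXP → NexpSubsetExpOfNpSubsetP → ClassBridges → PneNP is certified (by_contra: ¬PneNP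
and the bridges give NP ⊆ P, padding gives NEXP ⊆ EXP ∋ L_code, contradicting Target); the Assembly
item is restated as CodeSizeLangInNEXP → NexpSubsetExpOfNpSubsetP → ClassBridges → Target → PneNP
(rev 1 took P_bool_eq/NP_bool_eq as unlisted hypotheses; same content, now over listed items;
provable now — it is the body of closes, candidate proof attached — and NOT assumed by closes).
Definition sanity (support): LasserreAttainsCodeSize (0/1 moments of a maximum code are feasible at
every level, value A(n,d)) and LasserreFiniteConvergence (Laurent2003/Laurent2006 p.248: level ≥
A(n,d) is exact) pin the inline hierarchy to the printed one.
RANKED CRUXES. #2 PolyLevelLasserreMarginInexact (supersedes the rev-1 floor form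
PolyLevelLasserreInexact): ∀ polynomial p, ∀ θ < 1, for infinitely many n some d has a level-p(n)
feasible pseudo-moment y with Σ_v y_v ≥ A(n,d) + θ (margin-inexactness; θ ≤ 0 is trivial by
LasserreAttainsCodeSize; witnesses necessarily have 3 ≤ d ≤ n/2 once p(n) ≥ 2n, since d ≤ 2 and the
Plotkin range are exact by perfection/LasserreFiniteConvergence). Hardest and most informative: an
SOS-degree statement at degree poly(n) = polylog(#vertices) on the Hamming scheme; ¬#2 (some
polynomial level eventually exact within some θ < 1) would compute every A(n,d) in 2^{poly(n)} "in
principle". #3 DelsarteBoundInexactOnRay: ∃ δ ∈ (0,1/2) with ⌊Delsarte LP(n,⌊δn⌋)⌋ > A(n,⌊δn⌋) for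
infinitely many n — the first rung in the constant-rate regime, kept in its classical floor form
('Delsarte's bound is not tight'); attack: prove ℓ^(2)_+ or Schrijver2005 < ⌊ℓ^(1)_+⌋ along a ray
analytically (numerics: (25,6): Delsarte 48,148 vs Schrijver 47,998; (20,8): 290 vs 274, Laurent2006
Table 1). #4 ConstantLevelLasserreMarginInexact (supersedes ConstantLevelLasserreInexact): ∀ k, ∀ θ
< 1, level k has Σ_v y_v ≥ A(n,d) + θ for infinitely many (n,d) — shadow of the weaker sufficient
thesis L_code ∉ E (P = NP's literal promise 2^{O(m)}); k = 1 may follow from BestBrouwer1977-type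
families (thrice-shortened Hamming codes, plain LP not tight) and does follow on a ray from #3, k ≥
2 has no known infinite family. Logical web: #2 ⟹ #4 (p = k); #3 ⟹ (#4 at k = 1, every θ ≤ 1); X ⟹
#2 and (L_code ∉ E) ⟹ #4 informally via approximate poly-time SDP + rounding within the margin
[DeklerkVallentin2016] (not filed: formalising an ellipsoid/IPM solver in FinTM2 is out of scope) —
this implication is exactly why the rungs are stated with a margin θ < 1 and not with the floor
(refuter reviews 05747519, c3ba3f2b: ⌊ℓ⌋ is not computable from an ε-approximation when ℓ ∈ [A+1−2ε,
A+1)).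
KILL CRITERIA. (a) A theorem "some Lasserre level p(n) = poly(n) (or O(n)) is exact on H(n,d) within
a margin θ < 1 for all large n" is ¬#2 and kills X as a 2^{poly} thesis — the route contracts to
L_code ∉ E with #4/#3 (restate Target), or closes if even a constant level is shown margin-exact
eventually (¬#4). Mere floor-exactness (⌊ℓ^(p(n))⌋ = A eventually) refutes neither X nor #2 and only
sharpens the attack. (b) An algorithm for A(n,d) in 2^{poly(n)} (¬Target) closes the route. (c) #3
refuted (Delsarte floor-tight along every ray δ ∈ (0,1/2), all large n) would overturn the field's
beliefs (Samorodnitsky2001: LP value ≥ 2^{n(R_GV+R_LP1)/2}) — the route survives on #2/#4 but loses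
its most concrete rung; re-rank. Certified numerics that some fixed level is exact on every
tabulated (n,d), n ≤ 28, would remove #4's empirical footing (kit job for a grounder;
GijswijtMittelmannSchrijver2012 tables).
NOT DECOMPOSED YET. The E-version target and its own deciding theorem (file only on contraction); R⁺
(k-point bounds, CJJ LP hierarchies) and the coNE/proof-complexity face; the constructive face X_L
(incompressibility of near-extremal codes — a sibling thesis, not implied by X); the linear-code
sanity check (dimension of the best LINEAR code IS computable in 2^{O(n²)}: the thesis is about
unrestricted codes); the calibration "A(n,d) ∈ DTIME(2^{2^{o(n)}})"; named notions
lasserreStableBound / maxCodeSize (definition requests filed; cruxes are inline and self-contained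
meanwhile). The rev-1 floor forms PolyLevelLasserreInexact / ConstantLevelLasserreInexact are
superseded, not refuted: a floor witness family is a fortiori a margin witness family.
CHEAPEST FALSIFIER. For the line: exhibit a 2^{poly(n)}-time algorithm for A(n,d) of unrestricted
binary codes (¬Target) — the linear-code analogue exists (enumerate generator matrices, 2^{O(n²)}),
so the first check is whether any known exact method (Östergård-type clique search, CJJ complete
hierarchies for LINEAR codes, arXiv:2112.09221/2211.01248) transfers to unrestricted codes in
2^{poly(n)}; none does in print. For the rungs: a certified computation
(GijswijtMittelmannSchrijver2012 tables, n ≤ 28) showing level 2 / Schrijver2005 already equal to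
A(n,d) within θ < 1 on every tabulated instance where A(n,d) is known would strip #4 of all
empirical support; a proof that ϑ′(H(n,⌊δn⌋)) is attained by a code infinitely often on some ray
kills #3.

Novelty: Nearest prior art (searched 2026-08-15: lit read doi:10.1007/s10107-006-0030-3
pp.240-241,248,259-260; lit galaxy search "semidefinite programming bounds for codes" --star all (7
rows: Laurent/Lasserre books, CoreglianoJeronimoJonesLinialLoyfer2025 preprint read pp.1-3);
crossref for Schrijver2005, Schrijver1979, Samorodnitsky2001, Laurent2003,
GijswijtMittelmannSchrijver2012, BestBrouwer1977, DeklerkVallentin2016,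
KurpiszLeppanenMastrolilli2019, HartmanisImmermanSewelson1985; the card's own searches and two
refuter novelty audits (arXiv:2211.01248 p.3, arXiv:2112.09221); lean search over Literature
(LovaszTheta.lean, ExpPadding/NTIMEPadding/AvgCaseNE padding toolkit, no A(n,d), no
Lasserre-for-stable-sets)): (1) Laurent2006 = doi:10.1007/s10107-006-0030-3 (the hierarchy
ℓ^(k)(G(n,d)), level 1 = ϑ/ϑ′ = Delsarte, Schrijver between levels 1 and 2, finite convergence at α)
and Laurent2003; (2) CoreglianoJeronimoJones2022/2023 (arXiv:2112.09221, arXiv:2211.01248) and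
CoreglianoJeronimoJonesLinialLoyfer2025 — complete LP hierarchies for LINEAR codes, exact at level
n, and the explicit statement that asymptotic analysis of every hierarchy above Delsarte is open
("essentially nothing is known"); (3) Book1974 / HartmanisImmermanSewelson1985 — P = NP ⟹ E = NE ⟹
tally/exponential-scale functions computable, the folklore template shared with sibling cards
ramsey-numbers-beyond-exp and cyclotomic-tally-hartmanis (not routed at the time of opening). No
complexity-theoretic treatment of th  [refs: 10.1007/s10107-006-0030-3, 2211.01248, 2112.09221, doi:10.1007/s10107-006-0030-3, CoreglianoJeronimoJonesLinialLoyfer2025, Schrijver2005, Schrijver1979, Samorodnitsky2001, Laurent2003, GijswijtMittelmannSchrijver2012, BestBrouwer1977, DeklerkVallentin2016, KurpiszLeppanenMastrolilli2019, HartmanisImmermanSewelson1985, Laurent2006, CoreglianoJeronimoJones2022, Book1974]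

Barriers (technique_class: sos-hierarchy-exactness, tally-ne-vs-e, coding-theory): technique_class: sos-hierarchy-exactness, tally-ne-vs-e, coding-theory
- Literature.Barriers.PneNP.Relativization: applies only at thesis level — Target ⟹ PneNP through
the proved padding/bridge facts, so a proof of Target composes to a non-relativizing proof of P ≠ NP
and nobody expects to prove Target outright (it is NEXP ≠ EXP-hard in spirit). NOT evaded for
Target; the bet is the rungs: #2–#4 quantify over pseudo-moment matrices of one explicit SDP family
(lower bounds for a certificate CLASS, like all SOS-degree/proof-complexity lower bounds), outside
the barrier's `blocks` clause (no oracle-independent machine simulation anywhere).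
- Literature.Barriers.PneNP.RelativizationNarrow / Literature.Barriers.PneNP.BoundedRelativization /
Literature.Barriers.PneNP.Algebrization: same status — they bind the thesis-level step only; the
padding step NexpSubsetExpOfNpSubsetP relativizes harmlessly (it is the easy direction, proved
in-tree).
- Literature.Barriers.PneNP.NaturalProofs: not engaged — no property of Boolean functions/truth
tables is used; the hard object is one tally-type language (one instance per (n,d,M)), non-large by
construction, and the rungs are statements about PSD matrices in the Terwilliger algebra, not
circuit lower bounds.
- Literature.Barriers.PneNP.TSPExtensionComplexity /
Literature.Barriers.PneNP.TSPExtensionComplexityNarrow: those bound the SIZE of LPs/SDPs projecting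
to NP-hard polytopes uniformly in n; here the polytope STAB(H(n,d)) has 2^n vertices-w

History (route lifecycle, newest last):
- 2026-08-15T16:22:32Z · rev 2: restated Assembly (stmt-PneNP-2134), PolyLevelLasserreInexact (stmt-PneNP-2127), ConstantLevelLasserreInexact (stmt-PneNP-2129) — route-repair (rbadge g2, glue+cone): (1) drop import Literature.Computability.Complexity.ClayProblem — its OPEN conjecture NPNotSubsetPPoly was the only unprove (planner-rbadge-PneNP-DelsarteLasserre-f8302239-g2-0)
- 2026-08-16T04:13:55Z · AUTO-CRUX (backfill): Target — hypotheses of the deciding theorem that nothing in the route derives are cruxes (operator:999:1085951)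
- 2026-08-22T12:54:43Z · DORMANT — reconciler: no traction for 5.3 d (last activity item-evidence-added at 2026-08-17T04:03:36Z); parked, not closed — `ledger route dormant route-PneNP-DelsarteLa (operator:999:3076554)

sub-problem: PneNP · status: dormant · opened planner-plancard-PneNP-PneNP-delsarte-unfinis-784b3e90-0 2026-08-15T11:01:12Z · rev 2 · ledger route-PneNP-DelsarteLasserre
GENERATED by the gate from the ledger (D-0016/17). Provers cite these decls: `theorem foo : Summit.PneNP.PneNP.Theses.DelsarteLasserre.<Decl> := …` in Summits/PneNP/PneNP/Theorems/<Name>.lean.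
-/

namespace Summit.PneNP.PneNP.Theses.DelsarteLasserre

open scoped BigOperators Topology Manifold Classical MeasureTheory ProbabilityTheory Matrix InnerProductSpace ComplexConjugate ContinuousMap
open Filter Set Function TopologicalSpace MeasureTheory

attribute [summit_statement] _root_.PneNP

open Literature.PNP

/-- item stmt-PneNP-2126 · crux (kind.auto-crux: conjecture-grade) · rank 0 · open · by planner
why it might fail: Nothing known excludes a 2^{poly(n)} algorithm for A(n,d) (the LINEAR-code analogue IS in EXP: enumerate generator matrices in 2^{O(n²)}; CJJ hierarchies are complete for linear codes), and Target ⟹ NEXP ≠ EXP, so no relativizing proof exists — only the shadows #2–#4 are expected to close.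
sources: Book1974, HartmanisImmermanSewelson1985, Laurent2006, CoreglianoJeronimoJones2023, CoreglianoJeronimoJonesLinialLoyfer2025
[target] Thesis X of the card delsarte-unfinished-lasserre-exactness: the code-size language L_code
= {⟨1^n,⟨1^d,u⟩⟩ : bitsToNat u ≤ A(n,d)} (A(n,d) = indepNum of the conflict graph on Fin n → Bool, u
~ v iff u ≠ v ∧ hammingDist u v < d; n,d unary, threshold binary, |w| = 2n+2d+4+|u|) is not in EXP =
⋃_k DTIME(2^{m^k}); equivalently no algorithm computes A(n,d) in time 2^{poly(n)} (decision ↔ value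
by binary search over M ≤ 2^n). Implies NEXP ≠ EXP (L_code ∈ NE), hence nobody is expected to prove
it outright; it is the limit of the rungs #2–#4. Sources: Book1974; HartmanisImmermanSewelson1985;
Laurent2006; Delsarte1973. -/
@[route_item "route-PneNP-DelsarteLasserre", crux]
def Target : Prop :=
  ({w : List Bool | ∃ n d : ℕ, ∃ u : List Bool, w = Literature.Computability.Complexity.boolPair (List.replicate n true) (Literature.Computability.Complexity.boolPair (List.replicate d true) u) ∧ Literature.Computability.Complexity.bitsToNat u ≤ (SimpleGraph.fromRel fun x y : Fin n → Bool => hammingDist x y < d).indepNum} : Language Bool) ∉ Literature.Computability.Complexity.EXP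

/-- item stmt-PneNP-10734 · crux · rank 2 · open · by planner
why it might fail: The S₂≀Sₙ symmetry of H(n,d) may make level O(n)/poly(n) exact up to o(1): no Lasserre-rank lower bound for H(n,d) beyond numerics (n ≤ 28; Laurent2006 Tab.1, GMS2012), and witnesses need ℓ^(p(n)) ≥ A(n,d)+θ, θ near 1 — an analytic gap above every polynomial level ('elusive', CJJLL2025 p.2).
sources: Laurent2006, Laurent2003, KurpiszLeppanenMastrolilli2019, CoreglianoJeronimoJonesLinialLoyfer2025, GijswijtMittelmannSchrijver2012, DeklerkVallentin2016
[crux] Rung R of the card in MARGIN form (supersedes the rev-1 floor form PolyLevelLasserreInexact,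
per refuter route reviews 05747519/c3ba3f2b): for every polynomial p and every margin θ < 1, for
infinitely many n there are d and a level-p(n) feasible pseudo-moment vector y on subsets of {0,1}^n
(y_∅ = 1, y ≥ 0, y_{uv} = 0 when 1 ≤ dist(u,v) ≤ d−1, moment matrix (y_{I∪J})_{|I|,|J| ≤ p(n)} ⪰ 0 —
Laurent2006 (22) plus nonnegativity, i.e. between ℓ^(k)_+ and ℓ^(k)) with Σ_v y_v ≥ A(n,d) + θ. This
is exactly the computable shadow of Target: if for some p and some θ < 1 eventually ℓ^(p(n))(n,d) <
A(n,d) + θ for all d, then an ε-approximation ℓ̃ of the level-p(n) SDP value (dimension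
2^{O(n·p(n))}, ε = (1−θ)/3, time 2^{poly(n)} [DeklerkVallentin2016]) pins A(n,d) down as the unique
integer in [ℓ̃−ε−θ, ℓ̃+ε], putting L_code in EXP (¬Target); the floor form (θ = 1) is NOT implied by
Target, because ⌊ℓ⌋ cannot be read off an approximate value when ℓ ∈ [A+1−2ε, A+1). θ ≤ 0 is trivial
(LasserreAttainsCodeSize); witnesses need 3 ≤ d ≤ n/2 once p(n) ≥ 2n (d ≤ 2: exact at level 1; d >
n/2: A(n,d) ≤ 2n ≤ p(n), exact by LasserreFiniteConvergence). Natural attack: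
Fourier/Terwilliger-algebra pseud -/
@[route_item "route-PneNP-DelsarteLasserre"]
def PolyLevelLasserreMarginInexact : Prop :=
  ∀ p : Polynomial ℕ, ∀ θ : ℝ, θ < 1 → ∃ᶠ n : ℕ in Filter.atTop, ∃ d : ℕ, ∃ y : Finset (Fin n → Bool) → ℝ, y ∅ = 1 ∧ (∀ S, 0 ≤ y S) ∧ (∀ u v : Fin n → Bool, u ≠ v → hammingDist u v < d → y {u, v} = 0) ∧ (Matrix.of fun I J : {S : Finset (Fin n → Bool) // S.card ≤ p.eval n} => y (I.1 ∪ J.1)).PosSemidef ∧ ((SimpleGraph.fromRel fun u v : Fin n → Bool => hammingDist u v < d).indepNum : ℝ) + θ ≤ ∑ v : Fin n → Bool, y {v}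

/-- item stmt-PneNP-2128 · crux · rank 3 · open · by planner
why it might fail: Needs, i.o. on ONE ray d = ⌊δn⌋, an upper bound on A(n,d) ≥ 1 below Delsarte's LP optimum: every asymptotic bound in print is a level-1 dual (MRRW77), puncturing/parity give ϑ′(G(n,d)) = ϑ′(G(n−1,d−1)) (no slack), Schrijver2005/level 2 analysed only numerically, n ≤ 28 (CJJLL2025 p.2).
sources: Schrijver2005, Schrijver1979, Laurent2006, Samorodnitsky2001, McelieceEtAl1977, GijswijtMittelmannSchrijver2012
[crux] First rung in the constant-rate regime: for some δ ∈ (0,1/2) and infinitely many n, the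
level-1 bound with nonnegativity — = ϑ′(H(n,d)) = Delsarte's LP bound (Schrijver1979; Laurent2006
p.241) — at d = ⌊δn⌋ exceeds A(n,⌊δn⌋) by at least 1 (floor-inexactness: ⌊LP⌋ > A, so a fractional
LP optimum is not enough). Finite instances are known numerically on the δ ≈ 1/4 ray ((25,6):
Delsarte 48,148 > Schrijver 47,998 ≥ A; (20,8): 290 > 274; Laurent2006 Table 1, Schrijver2005), but
along a ray no value A(n,⌊δn⌋) is known for any large n and every known asymptotic upper bound is
itself a level-1 dual (McelieceEtAl1977), so a proof must show analytically that ℓ^(2)_+ /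
Schrijver's Terwilliger-algebra SDP (or any other certificate) is < ⌊ℓ^(1)_+⌋ for infinitely many n
on the ray; parity tricks give nothing (the even-weight subgraph of H(n+1,d+1) is isomorphic to
H(n,d)). Either answer is publishable: ¬(this) for every δ would make Delsarte's bound the true
answer at all rates, against the Gilbert–Varshamov belief (Samorodnitsky2001: LP value ≥
2^{n(R_GV+R_LP1)/2+o(n)}). Sources: Schrijver1979; Schrijver2005; Laurent2006; Samorodnitsky2001;
McelieceEtAl1977; GijswijtMittelmannSchrijver2 -/
@[route_item "route-PneNP-DelsarteLasserre"]
def DelsarteBoundInexactOnRay : Prop :=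
  ∃ δ : ℝ, 0 < δ ∧ δ < 1 / 2 ∧ ∃ᶠ n : ℕ in Filter.atTop, ∃ y : Finset (Fin n → Bool) → ℝ, y ∅ = 1 ∧ (∀ S, 0 ≤ y S) ∧ (∀ u v : Fin n → Bool, u ≠ v → hammingDist u v < ⌊δ * n⌋₊ → y {u, v} = 0) ∧ (Matrix.of fun I J : {S : Finset (Fin n → Bool) // S.card ≤ 1} => y (I.1 ∪ J.1)).PosSemidef ∧ ((SimpleGraph.fromRel fun u v : Fin n → Bool => hammingDist u v < ⌊δ * n⌋₊).indepNum : ℝ) + 1 ≤ ∑ v : Fin n → Bool, y {v}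

/-- item stmt-PneNP-10735 · crux · rank 4 · open · by planner
why it might fail: For k ≥ 2 no infinite family with ℓ^(k) ≥ A(n,d)+θ, θ near 1, is certified: A(n,d) is known exactly only on LP-tight or Plotkin-range parameters, where level 2/Schrijver2005 may absorb the slack (numerics close most small gaps, n ≤ 28; GMS2012); belief for k ≥ 2 rests on tables.
sources: BestBrouwer1977, Laurent2006, Schrijver2005, GijswijtMittelmannSchrijver2012, Laurent2003, CoreglianoJeronimoJonesLinialLoyfer2025
[crux] No fixed level finishes Delsarte's programme, MARGIN form (supersedes the rev-1 floor form
ConstantLevelLasserreInexact): for every k and every θ < 1, for infinitely many n some d has a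
level-k feasible pseudo-moment y (as in PolyLevelLasserreMarginInexact with p = k) with Σ_v y_v ≥
A(n,d) + θ. Computable shadow of the WEAKER sufficient thesis L_code ∉ E (P = NP literally promises
time 2^{O(m)}, m = Θ(n) the input length: a level k that is exact within some θ < 1 for all large n
is an SDP of dimension 2^{O(kn)} whose (1−θ)/3-approximation yields A(n,d)). Implied by
PolyLevelLasserreMarginInexact (p = k) and, at k = 1 on a ray, by DelsarteBoundInexactOnRay (floor ⟹
every margin θ ≤ 1); at k = 1 it should also follow from sporadic families where Delsarte's LP is
not tight although A(n,d) is known (thrice-shortened Hamming codes, A(2^r−4,3) = 2^{2^r−4−r},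
BestBrouwer1977 needed extra inequalities) — a grounder should confirm which of those survive level
2/Schrijver2005; for k ≥ 3 no infinite margin-inexact family is known and A(n,d) is known exactly
only on perfect-code parameters (LP tight) and in the Plotkin range (levels ≥ 2n exact). Sources:
BestBrouwer1977; Laurent2006; Sc -/
@[route_item "route-PneNP-DelsarteLasserre"]
def ConstantLevelLasserreMarginInexact : Prop :=
  ∀ k : ℕ, ∀ θ : ℝ, θ < 1 → ∃ᶠ n : ℕ in Filter.atTop, ∃ d : ℕ, ∃ y : Finset (Fin n → Bool) → ℝ, y ∅ = 1 ∧ (∀ S, 0 ≤ y S) ∧ (∀ u v : Fin n → Bool, u ≠ v → hammingDist u v < d → y {u, v} = 0) ∧ (Matrix.of fun I J : {S : Finset (Fin n → Bool) // S.card ≤ k} => y (I.1 ∪ J.1)).PosSemidef ∧ ((SimpleGraph.fromRel fun u v : Fin n → Bool => hammingDist u v < d).indepNum : ℝ) + θ ≤ ∑ v : Fin n → Bool, y {v}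

/-- item stmt-PneNP-10679 · support · rank 9 · closed · proved by Summit.PneNP.PneNP.Theorems.cookModelBridge_proof @ a9cf7dce24c0 (prover) · by planner
sources: CookClay2006, AroraBarakCC2009, Literature.Computability.Complexity.P_bool_eq_holds, Literature.Computability.Complexity.NP_bool_eq_holds
[support — KNOWN, already PROVED in the tree; model bridge used by the deciding theorem `closes`]
Cook's Clay-problem classes over {0,1} (Literature.Computability.Complexity.PNPWave0.P Bool and
PNPWave0.NP Bool, in which the summit statement PneNP is phrased) coincide with the tree's working
classes Classes.P = ⋃_k DTIME(n^k) and Nondeterministic.NP = polyExists P. Literally the conjunction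
of the PROVED Literature theorems Literature.Computability.Complexity.P_bool_eq_holds
(ClayProblem.lean) and Literature.Computability.Complexity.NP_bool_eq_holds
(ClayProblemProofs.lean): a prover closes it in one line, `theorem cookModelBridge :
SzkEntropy.CookModelBridge := ⟨P_bool_eq_holds, NP_bool_eq_holds⟩`, in a Theorems file importing
ClayProblemProofs. Filed as an ITEM rather than invoked inside `closes` so that the route FILE
imports neither ClayProblem (which declares the open conjecture NPNotSubsetPPoly) nor its proof cone
— the 2026-08-15 route-repair keeps the route's import and constant cones free of unproved named
facts. [AroraBarakCC2009 Def. 1.13 and 2.1; CookClay2006 §1] [difficulty: provable-now] -/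
@[route_item "route-PneNP-DelsarteLasserre", crux]
def ClassBridges : Prop :=
  Literature.Computability.Complexity.PNPWave0.P Bool = Literature.Computability.Complexity.Classes.P ∧ Literature.Computability.Complexity.PNPWave0.NP Bool = Literature.Computability.Complexity.Nondeterministic.NP

/-- `ClassBridges` holds: proved by `Summit.PneNP.PneNP.Theorems.cookModelBridge_proof` @ a9cf7dce24c0. -/
theorem ClassBridges_holds : ClassBridges := _root_.Summit.PneNP.PneNP.Theorems.cookModelBridge_proof

/-- item stmt-PneNP-2130 · support · rank 9 · closed · proved by Summit.PneNP.PneNP.Theorems.delsarteLasserre_codeSizeLangInNEXP_proof @ 46cc52409de4 (prover) · by planner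
sources: AroraBarak2009, Papadimitriou1994
[support] Frame fact F1: L_code ∈ NEXP (indeed NTIME(2^{m^2}) ⊆ NEXP via
NTIME_two_pow_sq_subset_NEXP): on input w = ⟨1^n,⟨1^d,u⟩⟩ (m = |w| ≥ 2n+4) guess a list of bitsToNat
u words of length n (≤ 2^n·(2n+2) ≤ 2^m bits when bitsToNat u ≤ 2^n; reject at once if bitsToNat u >
2^n), check format, distinctness and all pairwise hammingDist ≥ d in time poly(2^n) ≤ c·2^{m^2}.
Routine machine work with the tree's toolkits: mem_NTIME_of_prefixMachine (PrefixVerifiers.lean)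
with the exponential clock exists_timeComputable_expClock (NTIMEPadding.lean) and a CodeFP/brick
verifier (CodeFP.lean: rawE/listE, nodup, all, natLe, unLeNat; parse junk certificates with
boolUnpair/listBoolDecode); models: KarpCliqueNP.CLIQUE_mem_NP, logTruncLang_mem_NP. Sources:
AroraBarak2009 §2.6.2; Papadimitriou1994 §20.1. -/
@[route_item "route-PneNP-DelsarteLasserre", crux]
def CodeSizeLangInNEXP : Prop :=
  ({w : List Bool | ∃ n d : ℕ, ∃ u : List Bool, w = Literature.Computability.Complexity.boolPair (List.replicate n true) (Literature.Computability.Complexity.boolPair (List.replicate d true) u) ∧ Literature.Computability.Complexity.bitsToNat u ≤ (SimpleGraph.fromRel fun x y : Fin n → Bool => hammingDist x y < d).indepNum} : Language Bool) ∈ Literature.Computability.Complexity.NEXP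

/-- item stmt-PneNP-2131 · support · rank 9 · closed · proved by Summit.PneNP.PneNP.Theorems.delsarteLasserre_nexpSubsetExpOfNpSubsetP_proof @ 40a01ca6df4c (prover) · by planner
sources: Book1974, HartmanisImmermanSewelson1985, AroraBarak2009
[support] Frame fact F2 (upward padding, Book1974; HartmanisImmermanSewelson1985; AroraBarak2009 Thm
2.22): NP ⊆ P ⟹ NEXP ⊆ EXP in the tree's classes. Ten lines over proved tree lemmas: for L ∈
NTIME(2^{n^k}), padPre k L ∈ NTIME(2^n) (padPre_mem_NTIME_two_pow), exists_pad_mem_NP (a := 1) gives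
Lp ∈ NP with x ∈ · ↔ lpad 1 x ∈ Lp, hypothesis gives Lp ∈ P, preimage_mem_E (lpad_mem_FE 1) puts
(lpad 1)⁻¹' Lp = padPre k L in E ⊆ EXP, and mem_EXP_of_karpReducible (karpReducible_padPre k L)
gives L ∈ EXP (k = 0 member via NTIME_one_subset_NTIME_two_pow or directly). Sources: Book1974;
HartmanisImmermanSewelson1985; AroraBarak2009. -/
@[route_item "route-PneNP-DelsarteLasserre", crux]
def NexpSubsetExpOfNpSubsetP : Prop :=
  Literature.Computability.Complexity.Nondeterministic.NP ⊆ Literature.Computability.Complexity.Classes.P → Literature.Computability.Complexity.NEXP ⊆ Literature.Computability.Complexity.EXP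

/-- item stmt-PneNP-2132 · support · rank 9 · closed · proved by Summit.PneNP.PneNP.Theorems.delsarteLasserre_lasserreAttainsCodeSize_proof @ b4e51f3cad73 (prover) · by planner
sources: Laurent2006, Laurent2003
[support] Definition sanity / soundness of the inline hierarchy (Laurent2006 (17)-(20)): for every n
d t the 0/1 moment vector y_S = [S ⊆ C] of a maximum independent set C of the conflict graph
(exists_isNIndepSet_indepNum) is feasible at level t — y_∅ = 1, y ≥ 0, y_{uv} = 0 on conflicts,
moment matrix = v vᵀ with v_I = [I ⊆ C] (rank one PSD) — and has Σ_v y_{v} = A(n,d). Hence every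
level upper-bounds A(n,d) and the cruxes' '+1' is the honest floor gap. Sources: Laurent2006;
Laurent2003. -/
@[route_item "route-PneNP-DelsarteLasserre"]
def LasserreAttainsCodeSize : Prop :=
  ∀ n d t : ℕ, ∃ y : Finset (Fin n → Bool) → ℝ, y ∅ = 1 ∧ (∀ S, 0 ≤ y S) ∧ (∀ u v : Fin n → Bool, u ≠ v → hammingDist u v < d → y {u, v} = 0) ∧ (Matrix.of fun I J : {S : Finset (Fin n → Bool) // S.card ≤ t} => y (I.1 ∪ J.1)).PosSemidef ∧ ∑ v : Fin n → Bool, y {v} = ((SimpleGraph.fromRel fun u v : Fin n → Bool => hammingDist u v < d).indepNum : ℝ)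

/-- item stmt-PneNP-2133 · support · rank 9 · closed · proved by Summit.PneNP.PneNP.Theorems.delsarteLasserre_lasserreFiniteConvergence_proof @ 851229c278c7 (prover) · by planner
sources: Laurent2003, Laurent2006
[support] Known result (Laurent2003 §5 / Laurent2006 p.248: α(G) ≤ ℓ^(k)(G) with equality if k ≥
α(G)), specialised to the conflict graphs H(n,d) and the inline formulation (edge constraints only;
PSD-ness propagates y_I = 0 to every non-stable I with |I| ≤ 2t, Laurent2006 p.248; the added
nonnegativity only shrinks the feasible set): if A(n,d) ≤ t then every level-t feasible y has Σ_v
y_v ≤ A(n,d). Calibrates the cruxes (levels ≥ A(n,d) are exact, so crux witnesses live where A(n,d)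
> level) and is the in-tree form of 'the hierarchy is complete at exponential level'.
Finite-dimensional linear algebra (Möbius inversion on the moment matrix indexed by stable sets).
Sources: Laurent2003; Laurent2006. -/
@[route_item "route-PneNP-DelsarteLasserre"]
def LasserreFiniteConvergence : Prop :=
  ∀ n d t : ℕ, (SimpleGraph.fromRel fun u v : Fin n → Bool => hammingDist u v < d).indepNum ≤ t → ∀ y : Finset (Fin n → Bool) → ℝ, y ∅ = 1 → (∀ S, 0 ≤ y S) → (∀ u v : Fin n → Bool, u ≠ v → hammingDist u v < d → y {u, v} = 0) → (Matrix.of fun I J : {S : Finset (Fin n → Bool) // S.card ≤ t} => y (I.1 ∪ J.1)).PosSemidef → ∑ v : Fin n → Bool, y {v} ≤ ((SimpleGraph.fromRel fun u v : Fin n → Bool => hammingDist u v < d).indepNum : ℝ)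

-- earlier Assembly (stmt-PneNP-2134, replaced 2026-08-15T16:22:32Z -> stmt-PneNP-10733): retired by None — CodeSizeLangInNEXP → NexpSubsetExpOfNpSubsetP → Literature.Computability.Complexity.P_bool_eq → Literature.Computability.Complexity.NP_bool_eq → Target → PneNP
/-- item stmt-PneNP-10733 · assembly · rank 1 · closed · proved by Summit.PneNP.PneNP.Theorems.delsarteLasserre_assembly_proof @ c93395da820c (prover) · by planner
sources: Book1974, HartmanisImmermanSewelson1985, CookClay2006
[assembly] CodeSizeLangInNEXP → NexpSubsetExpOfNpSubsetP → ClassBridges → Target → PneNP (rev 2: the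
unlisted Literature facts P_bool_eq → NP_bool_eq of rev 1 are replaced by the listed support item
ClassBridges, which is literally their conjunction — same content, now a route item): if ¬PneNP then
every PNPWave0-NP language is in PNPWave0-P, ClassBridges rewrites this as Nondeterministic.NP ⊆
Classes.P, F2 gives NEXP ⊆ EXP, F1 gives L_code ∈ EXP, contradicting Target. Propositional, five
lines (by_contra) — it is verbatim the body of the certified deciding theorem closes : Target →
CodeSizeLangInNEXP → NexpSubsetExpOfNpSubsetP → ClassBridges → PneNP, which does NOT take Assembly
as a hypothesis; candidate proof attached as evidence (AssemblyEvidence.lean). Sources: Book1974;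
HartmanisImmermanSewelson1985. [difficulty: provable-now] -/
@[route_item "route-PneNP-DelsarteLasserre"]
def Assembly : Prop :=
  CodeSizeLangInNEXP → NexpSubsetExpOfNpSubsetP → ClassBridges → Target → PneNP

-- records of items no longer active in this route (dropped / restated):
-- earlier PolyLevelLasserreInexact (stmt-PneNP-2127, replaced 2026-08-15T16:22:32Z -> stmt-PneNP-10734): retired by None — ∀ p : Polynomial ℕ, ∃ᶠ n : ℕ in Filter.atTop, ∃ d : ℕ, ∃ y : Finset (Fin n → Bool) → ℝ, y ∅ = 1 ∧ (∀ S, 0 ≤ y S) ∧ (∀ u v : Fin n → Bool, u ≠ v → hammingDist u v < d → y {u, v} = 0) ∧ (Matrix.of fun I J : {S : Finset (Fin n → Bool) // S.card ≤ p.eval n} => y (I.1 ∪ J.1)).PosSemi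
-- earlier ConstantLevelLasserreInexact (stmt-PneNP-2129, replaced 2026-08-15T16:22:32Z -> stmt-PneNP-10735): retired by None — ∀ k : ℕ, ∃ᶠ n : ℕ in Filter.atTop, ∃ d : ℕ, ∃ y : Finset (Fin n → Bool) → ℝ, y ∅ = 1 ∧ (∀ S, 0 ≤ y S) ∧ (∀ u v : Fin n → Bool, u ≠ v → hammingDist u v < d → y {u, v} = 0) ∧ (Matrix.of fun I J : {S : Finset (Fin n → Bool) // S.card ≤ k} => y (I.1 ∪ J.1)).PosSemidef ∧ ((Simple

/-! D-0027 §2.1 — DECIDING THEOREM (planner-authored via `route open/edit --closes-file`; by planner-rbadge-PneNP-DelsarteLasserre-f8302239-g2-0 2026-08-15T16:22:32Z):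
its hypotheses are this route's items and its conclusion the sub-problem Statement (glue_lint), and it elaborates with this file. -/

@[closes "route-PneNP-DelsarteLasserre"] theorem closes (hT : Target) (hF1 : CodeSizeLangInNEXP) (hF2 : NexpSubsetExpOfNpSubsetP) (hF3 : ClassBridges) : _root_.PneNP := by
  by_contra hne
  refine hT (hF2 ?_ hF1)
  intro L hL
  by_contra hL'
  exact hne ⟨L, hF3.2 ▸ hL, hF3.1 ▸ hL'⟩

end Summit.PneNP.PneNP.Theses.DelsarteLasserre
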